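import Literature.Computability.Cryptography.RegevSIVPOfStages
import Literature.Computability.QuantumComplexity.ChainComposeUniform
import HarnessLib

/-!
# Regev 2009, Theorem 3.1 in machine form, II: `h₂` from the stage family alone; pqc.S19 (SIVP) from `hStage` alone

Topic `Computability/Cryptography` (family `pqc`), sequel of `RegevMainTheoremStages.lean`
(`Regev2009.thm_3_1_machine_of_stages hLoop hStage : h₂`) and `RegevSIVPOfStages.lean`
(`regev_lwe_to_sivp_quantum_of_stages hLoop hStage`, Lemma 3.17 being the theorem
`Regev2009.GIVPMachine.regev_dgs_to_givp_quantum`). The loop principle `hLoop` — iterated composition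
of a uniform quantum family along `chainLaw 0 S.family m x T` (`QuantumComplexity/StageChains.lean`),
the last handed-over string a prefix of the register of ONE uniform family, in law — is a THEOREM of
the tree: `ChainCompose.exists_chainFamily` (`QuantumComplexity/ChainCompose*.lean`; the parallel
construction `QuantumComplexity/SeqChain*.lean` proves the same statement as
`SeqChain.chainLaw_toOuterMeasure_le_kernel` + `SeqChain.family_isUniform`) — Bernstein–Vazirani 1997,
§8 (classical control of quantum subroutines) with Nielsen–Chuang 2010, §4.4 (deferred measurement),
in the tree's Clifford+`T` uniform-family model. This file records the consequences:

* **`Regev2009.thm_3_1_machine_of_stage (hStage) : h₂`** — Theorem 3.1 in machine form from the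
  stage family alone;
* **`regev_lwe_to_sivp_quantum_of_stage (hStage) : regev_lwe_to_sivp_quantum q α m`** — pqc.S19
  (SIVP form) rests on `hStage` ONLY (with `h₁` = `Regev2009.searchLWE_worstCase_of_avgCase`,
  `hLoop` = `ChainCompose.exists_chainFamily`, `h₃` = `regev_dgs_to_givp_quantum` all theorems);
* `regev_lwe_to_gapSVP_quantum_of_stage_of_lemma320 (hStage) (hL)` — the GapSVP form from the stage
  family and Lemma 3.20 in machine form.

What remains of pqc.S19 (SIVP) is exactly `hStage`: ONE uniform stage family realising Lemma 3.2
(the bootstrap) and Lemma 3.3 (the iterative step: Lemma 3.4 with the oracle `W`, and the quantum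
step Lemma 3.14) per stage. Everything here is PROVED; no named fact.

## References

* O. Regev, *On lattices, learning with errors, random linear codes, and cryptography*, J. ACM 56
  (2009), Theorem 1.1, Theorem 3.1 and its proof (p. 15), Lemmas 3.2, 3.3, 3.17, 3.20 [Regev2009].
* E. Bernstein, U. Vazirani, *Quantum complexity theory*, SIAM J. Comput. 26 (1997), §8
  [BernsteinVazirani1997].
* M. A. Nielsen, I. L. Chuang, *Quantum Computation and Quantum Information*, CUP 2010, §4.4
  [NielsenChuang2010].
-/

noncomputable section

open Filter Literature.Computability.Complexity Literature.Computability.Cryptography.LWE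
  Literature.Algebra.EuclideanLattices Literature.Computability.QuantumComplexity

namespace Literature.Computability.Cryptography

namespace Regev2009

section MainTheorem

variable (q : ℕ → ℕ) [∀ n, NeZero (q n)] (α : ℕ → ℝ)

/-- **Regev 2009, Theorem 3.1 (machine form `h₂`) from the stage family alone.**
`thm_3_1_machine_of_stages` with `hLoop := ChainCompose.exists_chainFamily`.
[cite: Regev2009, Theorem 3.1 (proof, p. 15)] -/
theorem thm_3_1_machine_of_stage
    (hStage : ∀ (m : ℕ → ℕ) (_ : IsPolyBounded m) (_ : IsPolyTimeParams q α m)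
      (_ : ∀ᶠ n : ℕ in atTop, 0 < α n ∧ α n < 1 ∧ 2 * Real.sqrt n < α n * q n)
      (_ : ∃ (W : UniformQCircuitFamily) (c : ℝ), 0 < c ∧
        W.SolvesSearchLWEWorstCase q (fun n => discretizedGaussian (q n) (α n)) m
          fun n => (2 : ℝ) ^ (-(c * n)))
      (ε : ℕ → ℝ), IsNegligible ε → (∀ n, 0 < ε n) →
      ∃ (S : UniformQCircuitFamily) (N : ℕ → ℕ) (mS : Polynomial ℕ)
        (encB : (n : ℕ) → (Fin (N n) → Fin n → ℤ) → List Bool) (νS : ℕ → ℝ) (θ : ℕ → ℝ),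
        IsNegligible νS ∧ (∀ n, 0 < n → α n * q n / Real.sqrt n ≤ θ n) ∧
        (∀ n (b b' : Fin (N n) → Fin n → ℤ) (z : List Bool), encB n b <+: z → encB n b' <+: z → b = b') ∧
        (∀ n (b : Fin (N n) → Fin n → ℤ) (w : List Bool) (j : Fin (N n)), (j : ℕ) = 0 →
          decodeLatticeVector n (encB n b ++ w) = b j) ∧
        (∀ n, 0 < N n) ∧
        ∀ᶠ n : ℕ in atTop, ∀ (I : LatticeInstance) (r : ℚ) (x : List Bool), I.n = n → I.IsNonsingular →
          x = GapSVPInstance.encode (I, r) →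
          ((2 : ℝ) ^ (2 * I.n) * successiveMinimum I.lattice I.n < levelRadius (θ I.n) (3 * I.n) r 0 →
            ((chainLaw 0 S.family (mS.eval x.length) x 1).map (readBatchE (encB I.n))).tvDist
              (idealBatch I (N I.n) (levelRadius (θ I.n) (3 * I.n) r 0)) ≤ νS I.n) ∧
          (∀ k, k < 3 * x.length →
            (k < 3 * I.n → Real.sqrt 2 * q I.n * smoothingParameter I.lattice (ε I.n) <
              levelRadius (θ I.n) (3 * I.n) r k) →
            ((chainLaw 0 S.family (mS.eval x.length) x (k + 2)).map (readBatchE (encB I.n))).tvDist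
                (idealBatch I (N I.n) (levelRadius (θ I.n) (3 * I.n) r (k + 1))) ≤
              ((chainLaw 0 S.family (mS.eval x.length) x (k + 1)).map (readBatchE (encB I.n))).tvDist
                  (idealBatch I (N I.n) (levelRadius (θ I.n) (3 * I.n) r k)) +
                if k < 3 * I.n then νS I.n else 0)) :
    ∀ (m : ℕ → ℕ) (_ : IsPolyBounded m) (_ : IsPolyTimeParams q α m)
      (_ : ∀ᶠ n : ℕ in atTop, 0 < α n ∧ α n < 1 ∧ 2 * Real.sqrt n < α n * q n)
      (_ : ∃ (W : UniformQCircuitFamily) (c : ℝ), 0 < c ∧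
        W.SolvesSearchLWEWorstCase q (fun n => discretizedGaussian (q n) (α n)) m
          fun n => (2 : ℝ) ^ (-(c * n)))
      (ε : ℕ → ℝ), IsNegligible ε → (∀ n, 0 < ε n) →
      ∃ (D : UniformQCircuitFamily) (ν : ℕ → ℝ), IsNegligible ν ∧ D.SamplesDGS (regevDGSBound α ε) ν :=
  thm_3_1_machine_of_stages q α (fun S T m => ChainCompose.exists_chainFamily S T m) hStage

end MainTheorem

end Regev2009

/-! ### pqc.S19 from the stage family alone (SIVP), resp. with Lemma 3.20 (GapSVP) -/

section Corollaries

variable (q : ℕ → ℕ) [∀ n, NeZero (q n)] (α : ℕ → ℝ) (m : ℕ → ℕ)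

/-- **pqc.S19 (SIVP form) rests on the stage family of Theorem 3.1 alone**:
`regev_lwe_to_sivp_quantum_of_stages` (`RegevSIVPOfStages.lean`: `h₁`, `h₃` proved) with
`hLoop := ChainCompose.exists_chainFamily`. [cite: Regev2009, Thm 1.1 from Thm 3.1 (proof) and Lemma 3.17] -/
theorem regev_lwe_to_sivp_quantum_of_stage
    (hStage : ∀ (m : ℕ → ℕ) (_ : IsPolyBounded m) (_ : IsPolyTimeParams q α m)
      (_ : ∀ᶠ n : ℕ in atTop, 0 < α n ∧ α n < 1 ∧ 2 * Real.sqrt n < α n * q n)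
      (_ : ∃ (W : UniformQCircuitFamily) (c : ℝ), 0 < c ∧
        W.SolvesSearchLWEWorstCase q (fun n => discretizedGaussian (q n) (α n)) m
          fun n => (2 : ℝ) ^ (-(c * n)))
      (ε : ℕ → ℝ), IsNegligible ε → (∀ n, 0 < ε n) →
      ∃ (S : UniformQCircuitFamily) (N : ℕ → ℕ) (mS : Polynomial ℕ)
        (encB : (n : ℕ) → (Fin (N n) → Fin n → ℤ) → List Bool) (νS : ℕ → ℝ) (θ : ℕ → ℝ),
        IsNegligible νS ∧ (∀ n, 0 < n → α n * q n / Real.sqrt n ≤ θ n) ∧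
        (∀ n (b b' : Fin (N n) → Fin n → ℤ) (z : List Bool), encB n b <+: z → encB n b' <+: z → b = b') ∧
        (∀ n (b : Fin (N n) → Fin n → ℤ) (w : List Bool) (j : Fin (N n)), (j : ℕ) = 0 →
          decodeLatticeVector n (encB n b ++ w) = b j) ∧
        (∀ n, 0 < N n) ∧
        ∀ᶠ n : ℕ in atTop, ∀ (I : LatticeInstance) (r : ℚ) (x : List Bool), I.n = n → I.IsNonsingular →
          x = GapSVPInstance.encode (I, r) →
          ((2 : ℝ) ^ (2 * I.n) * successiveMinimum I.lattice I.n < Regev2009.levelRadius (θ I.n) (3 * I.n) r 0 →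
            ((chainLaw 0 S.family (mS.eval x.length) x 1).map (Regev2009.readBatchE (encB I.n))).tvDist
              (Regev2009.idealBatch I (N I.n) (Regev2009.levelRadius (θ I.n) (3 * I.n) r 0)) ≤ νS I.n) ∧
          (∀ k, k < 3 * x.length →
            (k < 3 * I.n → Real.sqrt 2 * q I.n * smoothingParameter I.lattice (ε I.n) <
              Regev2009.levelRadius (θ I.n) (3 * I.n) r k) →
            ((chainLaw 0 S.family (mS.eval x.length) x (k + 2)).map (Regev2009.readBatchE (encB I.n))).tvDist
                (Regev2009.idealBatch I (N I.n) (Regev2009.levelRadius (θ I.n) (3 * I.n) r (k + 1))) ≤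
              ((chainLaw 0 S.family (mS.eval x.length) x (k + 1)).map (Regev2009.readBatchE (encB I.n))).tvDist
                  (Regev2009.idealBatch I (N I.n) (Regev2009.levelRadius (θ I.n) (3 * I.n) r k)) +
                if k < 3 * I.n then νS I.n else 0)) :
    regev_lwe_to_sivp_quantum q α m :=
  regev_lwe_to_sivp_quantum_of_stages q α m (fun S T m => ChainCompose.exists_chainFamily S T m) hStage

/-- **pqc.S19 (GapSVP form) from the stage family of Thm 3.1 and Lemma 3.20.**
[cite: Regev2009, Thm 1.1 from Thm 3.1 (proof), Lemma 3.20 and §3.3 (GMSS99)] -/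
theorem regev_lwe_to_gapSVP_quantum_of_stage_of_lemma320
    (hStage : ∀ (m : ℕ → ℕ) (_ : IsPolyBounded m) (_ : IsPolyTimeParams q α m)
      (_ : ∀ᶠ n : ℕ in atTop, 0 < α n ∧ α n < 1 ∧ 2 * Real.sqrt n < α n * q n)
      (_ : ∃ (W : UniformQCircuitFamily) (c : ℝ), 0 < c ∧
        W.SolvesSearchLWEWorstCase q (fun n => discretizedGaussian (q n) (α n)) m
          fun n => (2 : ℝ) ^ (-(c * n)))
      (ε : ℕ → ℝ), IsNegligible ε → (∀ n, 0 < ε n) →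
      ∃ (S : UniformQCircuitFamily) (N : ℕ → ℕ) (mS : Polynomial ℕ)
        (encB : (n : ℕ) → (Fin (N n) → Fin n → ℤ) → List Bool) (νS : ℕ → ℝ) (θ : ℕ → ℝ),
        IsNegligible νS ∧ (∀ n, 0 < n → α n * q n / Real.sqrt n ≤ θ n) ∧
        (∀ n (b b' : Fin (N n) → Fin n → ℤ) (z : List Bool), encB n b <+: z → encB n b' <+: z → b = b') ∧
        (∀ n (b : Fin (N n) → Fin n → ℤ) (w : List Bool) (j : Fin (N n)), (j : ℕ) = 0 →
          decodeLatticeVector n (encB n b ++ w) = b j) ∧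
        (∀ n, 0 < N n) ∧
        ∀ᶠ n : ℕ in atTop, ∀ (I : LatticeInstance) (r : ℚ) (x : List Bool), I.n = n → I.IsNonsingular →
          x = GapSVPInstance.encode (I, r) →
          ((2 : ℝ) ^ (2 * I.n) * successiveMinimum I.lattice I.n < Regev2009.levelRadius (θ I.n) (3 * I.n) r 0 →
            ((chainLaw 0 S.family (mS.eval x.length) x 1).map (Regev2009.readBatchE (encB I.n))).tvDist
              (Regev2009.idealBatch I (N I.n) (Regev2009.levelRadius (θ I.n) (3 * I.n) r 0)) ≤ νS I.n) ∧
          (∀ k, k < 3 * x.length →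
            (k < 3 * I.n → Real.sqrt 2 * q I.n * smoothingParameter I.lattice (ε I.n) <
              Regev2009.levelRadius (θ I.n) (3 * I.n) r k) →
            ((chainLaw 0 S.family (mS.eval x.length) x (k + 2)).map (Regev2009.readBatchE (encB I.n))).tvDist
                (Regev2009.idealBatch I (N I.n) (Regev2009.levelRadius (θ I.n) (3 * I.n) r (k + 1))) ≤
              ((chainLaw 0 S.family (mS.eval x.length) x (k + 1)).map (Regev2009.readBatchE (encB I.n))).tvDist
                  (Regev2009.idealBatch I (N I.n) (Regev2009.levelRadius (θ I.n) (3 * I.n) r k)) +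
                if k < 3 * I.n then νS I.n else 0))
    (hL : ∀ (γ : ℕ → ℝ), (∀ n, 1 ≤ γ n) →
      (∃ (D : UniformQCircuitFamily) (ν : ℕ → ℝ),
          IsNegligible ν ∧ D.SamplesDGS (Regev2009.dgsBoundDual γ) ν) →
      ∃ Q : UniformQCircuitFamily, ∀ᶠ n : ℕ in atTop, ∀ p : GapCVPInstance, p.1.I.n = n →
        (p ∈ GapCVP'.yes (fun k => 100 * Real.sqrt k * γ k) → 2 / 3 ≤ Q.acceptProb p.encode) ∧
        (p ∈ GapCVP'.no (fun k => 100 * Real.sqrt k * γ k) → Q.acceptProb p.encode ≤ 1 / 3)) :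
    regev_lwe_to_gapSVP_quantum q α m :=
  regev_lwe_to_gapSVP_quantum_of_thm31_of_lemma320 q α m (Regev2009.thm_3_1_machine_of_stage q α hStage) hL

end Corollaries

end Literature.Computability.Cryptography

end
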